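/-
Copyright (c) 2026. All rights reserved.
Released under Apache 2.0 license as described in the file LICENSE.
Authors: abc-iut cell, prover seat abc-iut-w5-d210 (wave 5, D-0068; NV-L4 rows).
-/
import Literature.AnabelianGeometry.AbsoluteAnabelian.GlobalRealifiedLine
import Literature.AnabelianGeometry.AbsoluteAnabelian.RelativeGrothendieckConjecture
import Mathlib.Algebra.Module.ULift
import Mathlib.Topology.Algebra.ContinuousMonoidHom
import HarnessLib

/-!
# [AbsTopIII] Definition 5.9 (i) / [pGC] Theorem A: two interfaces are NON-EMPTY (NV-L4 rows)

S. Mochizuki, *Topics in absolute anabelian geometry III: global reconstruction algorithms*,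
J. Math. Sci. Univ. Tokyo 22 (2015) 939–1156 [MochizukiAbsTopIII2015], Def 5.9 (i) (manuscript p. 143): the family
`{R_v, F_v}_{v ∈ V}` of realified lines of a Galois-theater with the weights `f_v·log(p_v)` resp. `2π`;
S. Mochizuki, *The local pro-p anabelian geometry of curves*, Invent. Math. 138 (1999) 319–423 [MochizukiLocAn1999],
Theorem A p. 3: profinite groups `Π_{X_K} ↠ Γ_K` over a fixed base group.

PROOF-ONLY non-vacuity companion (abc-iut NV-L4 rows «RealifiedFamily», «AugmentedProfiniteGrp»; kernel censuses
abc-iut-w5-d056 v3 / abc-iut-w5-d197 L4-v1: 12 resp. 65 consumers, zero producers) to the LANDED statement files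
`GlobalRealifiedLine.lean` (`RealifiedFamily`) and `RelativeGrothendieckConjecture.lean` (`AugmentedProfiniteGrp`),
neither of which is edited. Declares NO `def` / `instance` / `structure`.

* `RealifiedFamily.nonempty_model` — MODEL WEIGHTS: for any index type `V` with its archimedean/nonarchimedean
  marking `isArc` and MLF types `t`, the family `R_v := ℝ·F_v` (the standard line `ULift ℝ`, `F_v := 1`) with the
  printed weights `c_v = f_v·log(p_v)` / `c_v = 2π` — the typer's `RealifiedFamily.modelWeight`, positive by the
  typer's `RealifiedFamily.modelWeight_pos` (both consumed BY NAME).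
* `AugmentedProfiniteGrp.nonempty_split` — STRUCTURAL witness (honest label: a split extension, not the arithmetic
  `Π_{X_K} ↠ Γ_K` of a hyperbolic curve): `1 → H → G × H → G → 1` for arbitrary profinite `G`, `H`.
* `AugmentedProfiniteGrp.nonempty_degenerate` — DEGENERATE: the identity `G ↠ G` (`Δ = 1`).

Elementary; no named fact is consumed or introduced. Refereed pre-IUT anabelian geometry; nothing here bears on
[IUTchIII] Cor. 3.12; typed ≠ proved; instantiated ≠ endorsed.
-/

set_option autoImplicit false

universe u

namespace Literature.AnabelianGeometry.AbsoluteAnabelian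

/-- **The family of realified lines is inhabited at the MODEL weights** ([AbsTopIII] Def 5.9 (i), NV-L4 row
«RealifiedFamily»): for every index set `V`, marking `isArc : V → Bool` and MLF-type assignment `t`, the family
`R_v := ℝ·F_v` (standard real line, `F_v := 1 ≠ 0`, every element a real multiple of `F_v`) with weights
`c_v := RealifiedFamily.modelWeight isArc t v` (`= f_v·log p_v` at nonarchimedean `v`, `= 2π` at archimedean `v`),
positive by `RealifiedFamily.modelWeight_pos`. [cite: MochizukiAbsTopIII2015, Def 5.9 (i) p. 143] -/
theorem RealifiedFamily.nonempty_model (V : Type u) (isArc : V → Bool) (t : V → MLFType) :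
    Nonempty (RealifiedFamily V) :=
  ⟨{ R := fun _ =>
      { carrier := ULift.{u} ℝ
        frob := ULift.up 1
        frob_ne_zero := by
          intro h
          have h1 := congrArg ULift.down h
          simp only [ULift.zero_down] at h1
          exact one_ne_zero h1
        exists_eq_smul := fun x => ⟨x.down, by
          apply ULift.ext
          simp only [ULift.smul_down, smul_eq_mul, mul_one]⟩ }
     weight := RealifiedFamily.modelWeight isArc t
     weight_pos := RealifiedFamily.modelWeight_pos isArc t }⟩

/-- **Profinite groups over a fixed base are inhabited — SPLIT-EXTENSION witness** ([pGC] Thm A set-up, NV-L4 row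
«AugmentedProfiniteGrp»; honest label: structural, not the arithmetic `Π_{X_K} ↠ Γ_K`): for profinite `G`, `H`
the product `G × H` with its first projection `G × H ↠ G` (continuous, surjective; kernel `Δ = 1 × H ≅ H`), i.e.
the split extension `1 → H → G × H → G → 1`. [cite: MochizukiLocAn1999, Thm A p.3] -/
theorem AugmentedProfiniteGrp.nonempty_split (G H : ProfiniteGrp.{u}) : Nonempty (AugmentedProfiniteGrp G) :=
  ⟨{ arith := ProfiniteGrp.of (G × H)
     aug := ContinuousMonoidHom.fst G H
     aug_surjective := fun g => ⟨(g, 1), rfl⟩ }⟩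

/-- **Profinite groups over a fixed base are inhabited — DEGENERATE witness** ([pGC] Thm A set-up, NV-L4 row
«AugmentedProfiniteGrp»): the identity `G ↠ G` (geometric part `Δ = 1`). [cite: MochizukiLocAn1999, Thm A p.3] -/
theorem AugmentedProfiniteGrp.nonempty_degenerate (G : ProfiniteGrp.{u}) : Nonempty (AugmentedProfiniteGrp G) :=
  ⟨{ arith := G
     aug := ContinuousMonoidHom.id G
     aug_surjective := Function.surjective_id }⟩

/-- The split witness has NONTRIVIAL geometric part whenever `H` is nontrivial: `(1, h) ∈ Δ = Ker(G × H ↠ G)`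
(so the row is witnessed beyond the degenerate `Δ = 1` case). [cite: MochizukiLocAn1999, Thm A p.3] -/
theorem AugmentedProfiniteGrp.exists_geom_ne_bot (G H : ProfiniteGrp.{u}) [Nontrivial H] :
    ∃ A : AugmentedProfiniteGrp G, A.geom ≠ ⊥ := by
  obtain ⟨h, hh⟩ := exists_ne (1 : H)
  refine ⟨{ arith := ProfiniteGrp.of (G × H)
            aug := ContinuousMonoidHom.fst G H
            aug_surjective := fun g => ⟨(g, 1), rfl⟩ }, ?_⟩
  intro hbot
  have hmem : ((1, h) : G × H) ∈ AugmentedProfiniteGrp.geom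
      { arith := ProfiniteGrp.of (G × H)
        aug := ContinuousMonoidHom.fst G H
        aug_surjective := fun g => ⟨(g, 1), rfl⟩ } := by
    rw [AugmentedProfiniteGrp.mem_geom]
    rfl
  rw [hbot, Subgroup.mem_bot, Prod.mk_eq_one] at hmem
  exact hh hmem.2

end Literature.AnabelianGeometry.AbsoluteAnabelian
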